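import Summits.BirchSwinnertonDyer.Rank1Residual.GaloisImage.KuriharaRecordBSDpThreeLevelTwoEndOfFacts
import Summits.BirchSwinnertonDyer.Rank1Residual.Additive.X4ThreeKuriharaCertKernelLValue
import HarnessLib

/-!
# R1-61, part 3: the END-m2 record corollaries WITHOUT the analytic-rank binder — `r_an = 0` read off
# the level-zero unit field `δ̃_1 ≢ 0 (mod 27)` that every END-m2 record already carries
# (cell `b2b-bsdres`, team n1011, ROUTE-1 §33.3 / §36 R1-61; OWNERS row T-E2-REC; seat p18; the
# `m = 1` pattern is n1011-p03's `KuriharaRecordBSDpThreeLevelOneEndNoRank`)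

HONEST FRAMING (cell `b2b-bsdres`, run/shared/lean/b2b/bsd-rank1-residual/, verbatim in every
file): the goal of the cell is to DELETE the COMBINATION-SHAPED residual classes of the
Birch–Swinnerton-Dyer formula for ALL analytic-rank `≤ 1` elliptic curves over `ℚ` — "full BSD
formula for every rank `≤ 1` curve in class `C`" assembled STRICTLY from published theorems — so
that the rank-`≤ 1` remainder becomes exactly the CONSTRUCTION-SHAPED classes, which are TYPED
(missing-input `Prop`s), NOT attempted. This is not "finishing BSD". Team n1011 (N10/N11, the
additive block `X4 ∧ p = 3`): research route; PER-PAIR record shape, NOT a class theorem; TOOL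
theorems only (no definition, no named fact); nothing booked; no mark / label moved; the shapes
CLOSE NOTHING.  END-m2 is DEBT REDUCTION on class A2 (`BSD(E,3)` only where `ord₃(L(E,1)/Ω_E) ≤ 2`),
not coverage: CONDITIONAL on the UPPER-half facts of the X4 chain of record, Cassels–Tate, the
Poitou–Tate family at `3` (or the named fact `hPT`), Tate's `hEP`, and the ONE port
`KatoKuriharaPortThreeAt W 1 v₃` (FLAG `K22-Thm3.13-PORT@3`, construction-shaped, NOT in print at `3`);
NO [S24] fact of any level.  The Kurihara values stay EVIDENCE hypotheses of every record.

## What and why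

The four END-m2 record corollaries of parts 1–2 (`KuriharaRecordBSDpThreeLevelTwoEnd[OfFacts]`,
p298219 / p298767) carry `hr : W.analyticRank = 0` — on a record an EVIDENCE-grade hypothesis (LMFDB's
analytic rank) — although every one of them ALSO carries the level-zero unit field
`hunit₁ : kuriharaNumber D.f (3^3) 1 ψ₂₇ ≠ 0` (`δ̃_1 = [0]⁺_{D.f} mod 27 ≠ 0`), which IMPLIES
`L(E,1) ≠ 0`, i.e. `r_an = 0` under `hmod` — n1011-p03's
`analyticRank_eq_zero_of_kuriharaNumber_one_ne_zero` (p257658).  This file deletes the binder `hr` from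
all four (every other binder unchanged and in the same order), exactly as p03's
`KuriharaRecordBSDpThreeLevelOneEndNoRank` did one depth below:

* `Assembly.bsdp_three_of_towerSurj_of_levelTwoCertificates_of_baseRigidity_noRank`,
* `Assembly.bsdp_three_potMult_of_levelTwoCertificates_of_baseRigidity_noRank`,
* `Assembly.bsdp_three_of_towerSurj_of_levelTwoCertificates_of_facts_noRank`,
* `Assembly.bsdp_three_potMult_of_levelTwoCertificates_of_facts_noRank`.

So an END-m2 record reads: NAMED FACTS + PORT + ROW {model, tower (+ `ord₃ j < 0` on (M)),
`#E(ℚ₃)[3] = 3`, `3 ∤ ∏ c_ℓ` / `3 ∤ c₃`, optimal datum at `N ≤ 130000`} + CERTIFICATE + VALUES — and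
NO analytic-rank hypothesis.

References: C.-H. Kim, AJM 148 (2026) §1.4.3, Thm. 1.9 (6), Thm. 3.13 [Kim2022StructureSelmer];
B. Mazur, J. Tate, J. Teitelbaum, Invent. Math. 84 (1986) §I.8 [MazurTateTeitelbaum1986Invent];
K. Rubin, PCMI 18 (2011) Thm. 2.8.4, Cor. 2.8.9 [Rubin2011]; K. Kato, Astérisque 295 (2004)
Thm. 14.5 (3) [Kato2004Asterisque]; D. Delbourgo (1998) Prop. 4 [Delbourgo1998]; A. Agashe, K. Ribet,
W. Stein (2006) Thm. 2.6 [AgasheRibetStein2006]; J. H. Silverman, AEC (2009) X.4.2, X.4.14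
[SilvermanAEC2009].
-/

noncomputable section

open scoped Classical NumberField ContRepresentation
open Function Field NumberField IsDedekindDomain IsDedekindDomain.HeightOneSpectrum WeierstrassCurve
  CongruenceSubgroup
  Literature.NumberTheory.EllipticCurves Literature.NumberTheory.EllipticCurves.ModularForms
  Literature.NumberTheory.EllipticCurves.Rank1Residual
  Literature.NumberTheory.EllipticCurves.AgasheRibetStein2006
  Literature.NumberTheory.GaloisRepresentations
  Literature.NumberTheory.GaloisRepresentations.DiscreteGaloisModule Literature.NumberTheory.GaloisCohomology
  Rat.HeightOneSpectrum
  Summit.BirchSwinnertonDyer.Rank1Residual.Additive Summit.BirchSwinnertonDyer.Rank1Residual.X4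

namespace Summit.BirchSwinnertonDyer.Rank1Residual.GaloisImage.Assembly

/-! ### [S24]-free forms without `hr` -/

/-- **END-m2 RECORD COROLLARY, [S24]-FREE, WITHOUT the analytic-rank binder (potentially GOOD rows /
tower form).**  Exactly `bsdp_three_of_towerSurj_of_levelTwoCertificates_of_baseRigidity` (part 1) with
the binder `hr : W.analyticRank = 0` DELETED: `r_an = 0` is READ OFF the level-zero unit field
`hunit₁ : δ̃_1 ≢ 0 (mod 27)` by `analyticRank_eq_zero_of_kuriharaNumber_one_ne_zero`
(`δ̃_1 = [0]⁺_{D.f} mod 27` non-zero ⟹ `L(E,1) ≠ 0` ⟹ `r_an = 0` under `hmod`).  All other binders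
unchanged and in the same order: UPPER facts, `hCT`, the row (`hI hΔ hc₄ htower ht1 htam`), optimal
datum at `N ≤ 130000`, the PT family (`inv hperf hsum hcompl`), `hEP`, `v₃`, the port at `t = 1`, and
the certificate (`n hn hcyc ψ hψ hcert hzero₉ ψ₂₇ hunit₁`).  CLOSES NOTHING; values = EVIDENCE.
[cite: Kim2022StructureSelmer, §1.4.3 (PDF p. 7), Thm. 1.9 (6) and Thm. 3.13]
[cite: MazurTateTeitelbaum1986Invent, §I.8 (8.6)] [cite: Rubin2011, Thm. 2.8.4 and Cor. 2.8.9]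
[cite: Kato2004Asterisque, Thm. 14.5 (3) (p. 236)] [cite: AgasheRibetStein2006, Thm. 2.6 (p. 619)] -/
theorem bsdp_three_of_towerSurj_of_levelTwoCertificates_of_baseRigidity_noRank
    (hKatoS : Kato2004.rankZero_padicValNat_sha_le_sub_localTamagawa_of_additive_potGood_of_imageContainsSL2)
    (hDel : Delbourgo1998.prop4_rankZero_pow_dvd_constantCoeff)
    (hGZK : rank_eq_analyticRank_of_analyticRank_le_one) (hmod : hasEntireLFunction_rat)
    (hmodD : nonempty_modularParametrizationData)
    (hKatoχ : Wuthrich2014.kato_halfEigenCharIdeal_dvd_cyclotomicPrime_of_surjective)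
    (h26 : cremona_abs_maninConstant_eq_one_of_level_le)
    (hCT : exists_casselsTate_pairing (K := ℚ))
    (W : WeierstrassCurve ℚ) [W.IsElliptic] [W.IsGloballyMinimal]
    {E₀ : WeierstrassCurve ℤ} (hI : integralModelInt W = E₀)
    (hΔ : (3 : ℤ) ∣ E₀.Δ) (hc₄ : (3 : ℤ) ∣ E₀.c₄)
    (htower : ∀ m : ℕ, W.HasSurjectiveModNGaloisRep (3 ^ m : ℕ))
    (ht1 : Nat.card {Q : (W.baseChange ℚ_[3]).toAffine.Point // (3 : ℕ) • Q = 0} = 3 ^ 1)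
    (htam : ¬ 3 ∣ W.tamagawaProduct)
    {N : ℕ} [NeZero N] (hN : N ≤ 130000) (D : ModularParametrizationData W N)
    (hopt : ∀ z ∈ D.L.lattice, ∃ w ∈ periodLattice D.f, z = D.c * w)
    (inv : LocalInvariants ℚ 3) (hperf : inv.IsPerfect) (hsum : inv.SumLocalTermEqZero)
    (hcompl : inv.SelmerComplement)
    (hEP : ∀ v : HeightOneSpectrum (𝓞 ℚ), localEulerPoincareCharacteristic (v.adicCompletion ℚ))
    (v₃ : HeightOneSpectrum (𝓞 ℚ)) (hv₃ : ((3 : ℕ) : 𝓞 ℚ) ∈ v₃.asIdeal)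
    (hPort : KatoKuriharaPortThreeAt W 1 v₃)
    (n : ℕ) [NeZero n] (hn : Kato.IsKolyvaginProduct W 3 3 n)
    (hcyc : ∀ (ℓ : ℕ) [Fact ℓ.Prime], ℓ ∣ n →
      Nat.card {P : ((integralModelInt W).map (Int.castRingHom (ZMod ℓ))).toAffine.Point //
        3 • P = 0} ≤ 3)
    (ψ : (ℓ : ℕ) → (ZMod ℓ)ˣ →* Multiplicative (ZMod (3 ^ 2)))
    (hψ : ∀ ℓ ∈ n.primeFactors, Function.Surjective (ψ ℓ))
    (hcert : (3 : ZMod (3 ^ 2)) * kuriharaNumber D.f (3 ^ 2) n ψ ≠ 0)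
    (hzero₉ : (3 : ZMod (3 ^ 2)) * kuriharaNumber D.f (3 ^ 2) 1 ψ = 0)
    (ψ₂₇ : (ℓ : ℕ) → (ZMod ℓ)ˣ →* Multiplicative (ZMod (3 ^ 3)))
    (hunit₁ : kuriharaNumber D.f (3 ^ 3) 1 ψ₂₇ ≠ 0) :
    BSDp W 3 :=
  bsdp_three_of_towerSurj_of_levelTwoCertificates_of_baseRigidity hKatoS hDel hGZK hmod hmodD hKatoχ h26
    hCT W hI hΔ hc₄ htower ht1
    (analyticRank_eq_zero_of_kuriharaNumber_one_ne_zero hmod D (3 ^ 3) ψ₂₇ hunit₁) htam hN D hopt inv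
    hperf hsum hcompl hEP v₃ hv₃ hPort n hn hcyc ψ hψ hcert hzero₉ ψ₂₇ hunit₁

/-- **END-m2 RECORD COROLLARY, [S24]-FREE, WITHOUT the analytic-rank binder (potentially MULTIPLICATIVE
rows).**  Exactly `bsdp_three_potMult_of_levelTwoCertificates_of_baseRigidity` (part 1) with the binder
`hr : W.analyticRank = 0` DELETED (`r_an = 0` read off `hunit₁` by
`analyticRank_eq_zero_of_kuriharaNumber_one_ne_zero`); all other binders unchanged and in the same
order (the tower stays: the LOWER datum needs ONE `τ` at `3, 9, 27`).  CLOSES NOTHING; values = EVIDENCE.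
[cite: Kim2022StructureSelmer, §1.4.3 (PDF p. 7), Thm. 1.9 (6) and Thm. 3.13]
[cite: MazurTateTeitelbaum1986Invent, §I.8 (8.6)] [cite: Rubin2011, Thm. 2.8.4 and Cor. 2.8.9]
[cite: Delbourgo1998, Prop. 4 (p. 144)] [cite: AgasheRibetStein2006, Thm. 2.6 (p. 619)] -/
theorem bsdp_three_potMult_of_levelTwoCertificates_of_baseRigidity_noRank
    (hKatoS : Kato2004.rankZero_padicValNat_sha_le_sub_localTamagawa_of_additive_potGood_of_imageContainsSL2)
    (hDel : Delbourgo1998.prop4_rankZero_pow_dvd_constantCoeff)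
    (hGZK : rank_eq_analyticRank_of_analyticRank_le_one) (hmod : hasEntireLFunction_rat)
    (hmodD : nonempty_modularParametrizationData)
    (hKatoχ : Wuthrich2014.kato_halfEigenCharIdeal_dvd_cyclotomicPrime_of_surjective)
    (h26 : cremona_abs_maninConstant_eq_one_of_level_le)
    (hCT : exists_casselsTate_pairing (K := ℚ))
    (W : WeierstrassCurve ℚ) [W.IsElliptic] [W.IsGloballyMinimal]
    {E₀ : WeierstrassCurve ℤ} (hI : integralModelInt W = E₀)
    (hΔ : (3 : ℤ) ∣ E₀.Δ) (hc₄ : (3 : ℤ) ∣ E₀.c₄)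
    (htower : ∀ m : ℕ, W.HasSurjectiveModNGaloisRep (3 ^ m : ℕ)) (hjneg : padicValRat 3 W.j < 0)
    (hc3 : ¬ 3 ∣ (W.baseChange ℚ_[3]).localTamagawaNumber ℤ_[3])
    (ht1 : Nat.card {Q : (W.baseChange ℚ_[3]).toAffine.Point // (3 : ℕ) • Q = 0} = 3 ^ 1)
    {N : ℕ} [NeZero N] (hN : N ≤ 130000) (D : ModularParametrizationData W N)
    (hopt : ∀ z ∈ D.L.lattice, ∃ w ∈ periodLattice D.f, z = D.c * w)
    (inv : LocalInvariants ℚ 3) (hperf : inv.IsPerfect) (hsum : inv.SumLocalTermEqZero)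
    (hcompl : inv.SelmerComplement)
    (hEP : ∀ v : HeightOneSpectrum (𝓞 ℚ), localEulerPoincareCharacteristic (v.adicCompletion ℚ))
    (v₃ : HeightOneSpectrum (𝓞 ℚ)) (hv₃ : ((3 : ℕ) : 𝓞 ℚ) ∈ v₃.asIdeal)
    (hPort : KatoKuriharaPortThreeAt W 1 v₃)
    (n : ℕ) [NeZero n] (hn : Kato.IsKolyvaginProduct W 3 3 n)
    (hcyc : ∀ (ℓ : ℕ) [Fact ℓ.Prime], ℓ ∣ n →
      Nat.card {P : ((integralModelInt W).map (Int.castRingHom (ZMod ℓ))).toAffine.Point //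
        3 • P = 0} ≤ 3)
    (ψ : (ℓ : ℕ) → (ZMod ℓ)ˣ →* Multiplicative (ZMod (3 ^ 2)))
    (hψ : ∀ ℓ ∈ n.primeFactors, Function.Surjective (ψ ℓ))
    (hcert : (3 : ZMod (3 ^ 2)) * kuriharaNumber D.f (3 ^ 2) n ψ ≠ 0)
    (hzero₉ : (3 : ZMod (3 ^ 2)) * kuriharaNumber D.f (3 ^ 2) 1 ψ = 0)
    (ψ₂₇ : (ℓ : ℕ) → (ZMod ℓ)ˣ →* Multiplicative (ZMod (3 ^ 3)))
    (hunit₁ : kuriharaNumber D.f (3 ^ 3) 1 ψ₂₇ ≠ 0) :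
    BSDp W 3 :=
  bsdp_three_potMult_of_levelTwoCertificates_of_baseRigidity hKatoS hDel hGZK hmod hmodD hKatoχ h26 hCT
    W hI hΔ hc₄ htower hjneg hc3 ht1
    (analyticRank_eq_zero_of_kuriharaNumber_one_ne_zero hmod D (3 ^ 3) ψ₂₇ hunit₁) hN D hopt inv hperf
    hsum hcompl hEP v₃ hv₃ hPort n hn hcyc ψ hψ hcert hzero₉ ψ₂₇ hunit₁

/-! ### Named-facts forms without `hr` -/

/-- **END-m2 RECORD COROLLARY, NAMED-FACTS form, WITHOUT the analytic-rank binder (potentially GOOD rows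
/ tower form).**  Exactly `bsdp_three_of_towerSurj_of_levelTwoCertificates_of_facts` (part 2) with `hr`
DELETED (read off `hunit₁`); all other binders unchanged and in the same order.  CLOSES NOTHING.
[cite: Kim2022StructureSelmer, §1.4.3 (PDF p. 7), Thm. 1.9 (6) and Thm. 3.13]
[cite: MazurTateTeitelbaum1986Invent, §I.8 (8.6)] [cite: MilneADT2006, Ch. I, Thm. 4.10]
[cite: Kato2004Asterisque, Thm. 14.5 (3) (p. 236)] [cite: AgasheRibetStein2006, Thm. 2.6 (p. 619)] -/
theorem bsdp_three_of_towerSurj_of_levelTwoCertificates_of_facts_noRank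
    (hKatoS : Kato2004.rankZero_padicValNat_sha_le_sub_localTamagawa_of_additive_potGood_of_imageContainsSL2)
    (hDel : Delbourgo1998.prop4_rankZero_pow_dvd_constantCoeff)
    (hGZK : rank_eq_analyticRank_of_analyticRank_le_one) (hmod : hasEntireLFunction_rat)
    (hmodD : nonempty_modularParametrizationData)
    (hKatoχ : Wuthrich2014.kato_halfEigenCharIdeal_dvd_cyclotomicPrime_of_surjective)
    (h26 : cremona_abs_maninConstant_eq_one_of_level_le)
    (hCT : exists_casselsTate_pairing (K := ℚ))
    (W : WeierstrassCurve ℚ) [W.IsElliptic] [W.IsGloballyMinimal]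
    {E₀ : WeierstrassCurve ℤ} (hI : integralModelInt W = E₀)
    (hΔ : (3 : ℤ) ∣ E₀.Δ) (hc₄ : (3 : ℤ) ∣ E₀.c₄)
    (htower : ∀ m : ℕ, W.HasSurjectiveModNGaloisRep (3 ^ m : ℕ))
    (ht1 : Nat.card {Q : (W.baseChange ℚ_[3]).toAffine.Point // (3 : ℕ) • Q = 0} = 3 ^ 1)
    (htam : ¬ 3 ∣ W.tamagawaProduct)
    {N : ℕ} [NeZero N] (hN : N ≤ 130000) (D : ModularParametrizationData W N)
    (hopt : ∀ z ∈ D.L.lattice, ∃ w ∈ periodLattice D.f, z = D.c * w)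
    (hPT : poitouTate_selmerStructure_duality ℚ)
    (hEP : ∀ v : HeightOneSpectrum (𝓞 ℚ), localEulerPoincareCharacteristic (v.adicCompletion ℚ))
    (v₃ : HeightOneSpectrum (𝓞 ℚ)) (hv₃ : ((3 : ℕ) : 𝓞 ℚ) ∈ v₃.asIdeal)
    (hPort : KatoKuriharaPortThreeAt W 1 v₃)
    (n : ℕ) [NeZero n] (hn : Kato.IsKolyvaginProduct W 3 3 n)
    (hcyc : ∀ (ℓ : ℕ) [Fact ℓ.Prime], ℓ ∣ n →
      Nat.card {P : ((integralModelInt W).map (Int.castRingHom (ZMod ℓ))).toAffine.Point //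
        3 • P = 0} ≤ 3)
    (ψ : (ℓ : ℕ) → (ZMod ℓ)ˣ →* Multiplicative (ZMod (3 ^ 2)))
    (hψ : ∀ ℓ ∈ n.primeFactors, Function.Surjective (ψ ℓ))
    (hcert : (3 : ZMod (3 ^ 2)) * kuriharaNumber D.f (3 ^ 2) n ψ ≠ 0)
    (hzero₉ : (3 : ZMod (3 ^ 2)) * kuriharaNumber D.f (3 ^ 2) 1 ψ = 0)
    (ψ₂₇ : (ℓ : ℕ) → (ZMod ℓ)ˣ →* Multiplicative (ZMod (3 ^ 3)))
    (hunit₁ : kuriharaNumber D.f (3 ^ 3) 1 ψ₂₇ ≠ 0) :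
    BSDp W 3 :=
  bsdp_three_of_towerSurj_of_levelTwoCertificates_of_facts hKatoS hDel hGZK hmod hmodD hKatoχ h26 hCT W hI
    hΔ hc₄ htower ht1 (analyticRank_eq_zero_of_kuriharaNumber_one_ne_zero hmod D (3 ^ 3) ψ₂₇ hunit₁) htam
    hN D hopt hPT hEP v₃ hv₃ hPort n hn hcyc ψ hψ hcert hzero₉ ψ₂₇ hunit₁

/-- **END-m2 RECORD COROLLARY, NAMED-FACTS form, WITHOUT the analytic-rank binder (potentially
MULTIPLICATIVE rows).**  Exactly `bsdp_three_potMult_of_levelTwoCertificates_of_facts` (part 2) with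
`hr` DELETED (read off `hunit₁`); all other binders unchanged and in the same order.  CLOSES NOTHING.
[cite: Kim2022StructureSelmer, §1.4.3 (PDF p. 7), Thm. 1.9 (6) and Thm. 3.13]
[cite: MazurTateTeitelbaum1986Invent, §I.8 (8.6)] [cite: MilneADT2006, Ch. I, Thm. 4.10]
[cite: Delbourgo1998, Prop. 4 (p. 144)] [cite: AgasheRibetStein2006, Thm. 2.6 (p. 619)] -/
theorem bsdp_three_potMult_of_levelTwoCertificates_of_facts_noRank
    (hKatoS : Kato2004.rankZero_padicValNat_sha_le_sub_localTamagawa_of_additive_potGood_of_imageContainsSL2)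
    (hDel : Delbourgo1998.prop4_rankZero_pow_dvd_constantCoeff)
    (hGZK : rank_eq_analyticRank_of_analyticRank_le_one) (hmod : hasEntireLFunction_rat)
    (hmodD : nonempty_modularParametrizationData)
    (hKatoχ : Wuthrich2014.kato_halfEigenCharIdeal_dvd_cyclotomicPrime_of_surjective)
    (h26 : cremona_abs_maninConstant_eq_one_of_level_le)
    (hCT : exists_casselsTate_pairing (K := ℚ))
    (W : WeierstrassCurve ℚ) [W.IsElliptic] [W.IsGloballyMinimal]
    {E₀ : WeierstrassCurve ℤ} (hI : integralModelInt W = E₀)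
    (hΔ : (3 : ℤ) ∣ E₀.Δ) (hc₄ : (3 : ℤ) ∣ E₀.c₄)
    (htower : ∀ m : ℕ, W.HasSurjectiveModNGaloisRep (3 ^ m : ℕ)) (hjneg : padicValRat 3 W.j < 0)
    (hc3 : ¬ 3 ∣ (W.baseChange ℚ_[3]).localTamagawaNumber ℤ_[3])
    (ht1 : Nat.card {Q : (W.baseChange ℚ_[3]).toAffine.Point // (3 : ℕ) • Q = 0} = 3 ^ 1)
    {N : ℕ} [NeZero N] (hN : N ≤ 130000) (D : ModularParametrizationData W N)
    (hopt : ∀ z ∈ D.L.lattice, ∃ w ∈ periodLattice D.f, z = D.c * w)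
    (hPT : poitouTate_selmerStructure_duality ℚ)
    (hEP : ∀ v : HeightOneSpectrum (𝓞 ℚ), localEulerPoincareCharacteristic (v.adicCompletion ℚ))
    (v₃ : HeightOneSpectrum (𝓞 ℚ)) (hv₃ : ((3 : ℕ) : 𝓞 ℚ) ∈ v₃.asIdeal)
    (hPort : KatoKuriharaPortThreeAt W 1 v₃)
    (n : ℕ) [NeZero n] (hn : Kato.IsKolyvaginProduct W 3 3 n)
    (hcyc : ∀ (ℓ : ℕ) [Fact ℓ.Prime], ℓ ∣ n →
      Nat.card {P : ((integralModelInt W).map (Int.castRingHom (ZMod ℓ))).toAffine.Point //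
        3 • P = 0} ≤ 3)
    (ψ : (ℓ : ℕ) → (ZMod ℓ)ˣ →* Multiplicative (ZMod (3 ^ 2)))
    (hψ : ∀ ℓ ∈ n.primeFactors, Function.Surjective (ψ ℓ))
    (hcert : (3 : ZMod (3 ^ 2)) * kuriharaNumber D.f (3 ^ 2) n ψ ≠ 0)
    (hzero₉ : (3 : ZMod (3 ^ 2)) * kuriharaNumber D.f (3 ^ 2) 1 ψ = 0)
    (ψ₂₇ : (ℓ : ℕ) → (ZMod ℓ)ˣ →* Multiplicative (ZMod (3 ^ 3)))
    (hunit₁ : kuriharaNumber D.f (3 ^ 3) 1 ψ₂₇ ≠ 0) :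
    BSDp W 3 :=
  bsdp_three_potMult_of_levelTwoCertificates_of_facts hKatoS hDel hGZK hmod hmodD hKatoχ h26 hCT W hI
    hΔ hc₄ htower hjneg hc3 ht1
    (analyticRank_eq_zero_of_kuriharaNumber_one_ne_zero hmod D (3 ^ 3) ψ₂₇ hunit₁) hN D hopt hPT hEP v₃
    hv₃ hPort n hn hcyc ψ hψ hcert hzero₉ ψ₂₇ hunit₁

end Summit.BirchSwinnertonDyer.Rank1Residual.GaloisImage.Assembly

end
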